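import Mathlib.Algebra.Lie.Semisimple.Lemmas
import Mathlib.Algebra.Lie.CartanCriterion
import Mathlib.Order.CompactlyGenerated.Basic
import HarnessLib

/-!
# A Lie algebra with a faithful completely reducible representation is reductive: its radical is central (Lie's theorem)

Topic `Literature/Algebra/Lie`. Theorems only (no definition, no named fact, D-0026); Mathlib-level Lie theory in
Mathlib's vocabulary (`LieAlgebra.radical`, `LieAlgebra.center`, `LieAlgebra.HasCentralRadical` = «reductive»,
`LieAlgebra.HasTrivialRadical` = «semisimple» in characteristic `0`). Written for the cell `pub-hodgecm2` (COR-CM), seat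
`b27` (count-neutral own lane MT-REDUCTIVE): the Lie step of «the Hodge group of a polarizable Hodge structure is
reductive» (Deligne, LNM 900, I Prop. 3.6), consumed by
`Literature/AlgebraicGeometry/Motives/HodgeThetaSubalgebraSemisimple` with the complexified Hodge Lie algebra acting
on `V_ℂ` (completely reducible by the positivity of the Hodge form).

PRINTED RESULT. N. Bourbaki, *Lie Groups and Lie Algebras*, Ch. I §6.4 Prop. 5 / J. E. Humphreys, GTM 9, §19.1
(«Let `L ⊆ gl(V)` (`V` finite dimensional) … if `L` acts completely reducibly on `V` then `L` is reductive») and the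
proof of Prop. 19.1(a) via §4.1 (Lie's theorem: «a solvable ideal acts by scalars on each irreducible
constituent»). Mathlib has the IRREDUCIBLE case (`LieAlgebra.hasCentralRadical_and_of_isIrreducible_of_isFaithful`);
this file does the COMPLETELY REDUCIBLE case by the same argument, atom by atom.

SETTING. `k` a field of characteristic `0`; `L` a finite-dimensional Lie algebra over `k`; `M` a finite-dimensional
`L`-module which is TRIANGULARIZABLE (`LieModule.IsTriangularizable k L M`: all eigenvalues in `k` — automatic for `k`
algebraically closed) and COMPLETELY REDUCIBLE (`ComplementedLattice (LieSubmodule k L M)`: every Lie submodule has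
a complementary Lie submodule; equivalently `M` is the sum of its irreducible submodules, Mathlib
`complementedLattice_iff_isAtomistic`).

RESULTS.
* `exists_forall_lie_eq_smul_of_isAtom` — on an IRREDUCIBLE submodule `N` (an atom of the lattice) the radical
  `rad L` acts by scalars: `⁅x, m⁆ = χ(x) m` for `x ∈ rad L`, `m ∈ N` (Lie's theorem
  `LieModule.exists_nontrivial_weightSpace_of_isSolvable` for the solvable Lie algebra `rad L` on `N`, and the
  invariance lemma `LieModule.weightSpaceOfIsLieTower`: the weight space is an `L`-submodule, hence all of `N`).
* `lie_lie_radical_eq_zero` — for completely reducible `M`: `⁅⁅y, x⁆, m⁆ = 0` for all `y ∈ L`, `x ∈ rad L`,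
  `m ∈ M` (`[L, rad L]` kills every atom, and `M` is the supremum of its atoms).
* **`hasCentralRadical_of_complementedLattice`** — if moreover `M` is FAITHFUL then `rad L = Z(L)`
  (`LieAlgebra.HasCentralRadical k L`: «`L` is reductive»).
* **`hasTrivialRadical_of_complementedLattice_of_center_eq_bot`** — if moreover `Z(L) = 0` then `rad L = 0`
  (`LieAlgebra.HasTrivialRadical k L`; with Mathlib's Cartan criterion `LieAlgebra.HasTrivialRadical.instIsKilling`
  and `LieAlgebra.IsKilling.instSemisimple` this is «`L` is semisimple»).

## References

* [Humphreys1972] J. E. Humphreys, *Introduction to Lie Algebras and Representation Theory*, GTM 9 (1972), §4.1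
  (Lie's theorem), §19.1 Prop. (b) (completely reducible ⟹ reductive).
* N. Bourbaki, *Lie Groups and Lie Algebras, Chapters 1–3*, Ch. I §6.4 Prop. 5.
* [Deligne1982HodgeCycles] P. Deligne, *Hodge cycles on abelian varieties*, LNM 900 (1982), I Prop. 3.6 (the
  consumer's source).
-/

namespace Literature.Algebra.Lie

open LieAlgebra LieModule

variable {k L M : Type*} [Field k] [CharZero k]
  [LieRing L] [LieAlgebra k L] [Module.Finite k L]
  [AddCommGroup M] [Module k M] [LieRingModule L M] [LieModule k L M] [Module.Finite k M]
  [LieModule.IsTriangularizable k L M]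

/-- **On an irreducible submodule the radical acts by scalars** (Lie's theorem + the invariance lemma): for an atom
`N` of the lattice of Lie submodules of `M` there is a linear form `χ` on `rad L` with `⁅x, m⁆ = χ(x) • m` for all
`x ∈ rad L`, `m ∈ N`. [cite: Humphreys1972, §4.1] -/
theorem exists_forall_lie_eq_smul_of_isAtom {N : LieSubmodule k L M} (hN : IsAtom N) :
    ∃ χ : Module.Dual k (radical k L), ∀ x : radical k L, ∀ m ∈ N, ⁅(x : L), m⁆ = χ x • m := by
  have hNbot : N ≠ ⊥ := hN.1
  haveI : Nontrivial N := (LieSubmodule.nontrivial_iff_ne_bot k L M).2 hNbot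
  obtain ⟨χ, hχ⟩ : ∃ χ : Module.Dual k (radical k L), Nontrivial (weightSpace N χ) :=
    exists_nontrivial_weightSpace_of_isSolvable k (radical k L) N
  -- the weight space is an `L`-submodule of `N`, non-zero, hence all of `N`
  let W : LieSubmodule k L N := weightSpaceOfIsLieTower k N χ
  have hW : Nontrivial W := hχ
  have hWne : W ≠ ⊥ := (LieSubmodule.nontrivial_iff_ne_bot k L N).1 hW
  have hmap_ne : W.map N.incl ≠ ⊥ := by
    intro h
    apply hWne
    have hinj := LieSubmodule.map_injective_of_injective (f := N.incl) (LieSubmodule.injective_incl N)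
    apply hinj
    rw [h, LieSubmodule.map_bot]
  have hmap_eq : W.map N.incl = N :=
    ((hN.le_iff.1 LieSubmodule.map_incl_le).resolve_left hmap_ne)
  refine ⟨χ, fun x m hm => ?_⟩
  have hm' : m ∈ W.map N.incl := by rw [hmap_eq]; exact hm
  obtain ⟨w, hw, hwm⟩ := (LieSubmodule.mem_map _).1 hm'
  have hw' : ∀ y : radical k L, ⁅y, (w : N)⁆ = χ y • w := by
    simpa [W, weightSpaceOfIsLieTower, mem_weightSpace] using hw
  have e := congrArg (fun v : N => (v : M)) (hw' x)
  simp only [LieSubmodule.coe_smul] at e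
  rw [LieSubmodule.incl_apply] at hwm
  rw [← hwm]
  exact e

/-- **`[L, rad L]` kills a completely reducible module**: `⁅⁅y, x⁆, m⁆ = 0` for `y ∈ L`, `x ∈ rad L` and every `m`,
when every Lie submodule of `M` has a complement. On an atom `N`, `x` acts as the scalar `χ(x)` and `⁅y, m⁆ ∈ N`, so
`⁅⁅y,x⁆,m⁆ = ⁅y, χ(x) m⁆ - ⁅x, ⁅y, m⁆⁆ = 0`; and `M` is the supremum of its atoms
(`complementedLattice_iff_isAtomistic`). [cite: Humphreys1972, §19.1] -/
theorem lie_lie_radical_eq_zero [ComplementedLattice (LieSubmodule k L M)] (y : L) {x : L}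
    (hx : x ∈ radical k L) (m : M) : ⁅⁅y, x⁆, m⁆ = 0 := by
  -- the operator `⁅⁅y, x⁆, ·⁆` kills every atom
  have hatom : ∀ N : LieSubmodule k L M, IsAtom N → ∀ m ∈ N, ⁅⁅y, x⁆, m⁆ = 0 := by
    intro N hN m hm
    obtain ⟨χ, hχ⟩ := exists_forall_lie_eq_smul_of_isAtom hN
    have h1 : ⁅x, m⁆ = χ ⟨x, hx⟩ • m := hχ ⟨x, hx⟩ m hm
    have h2 : ⁅x, ⁅y, m⁆⁆ = χ ⟨x, hx⟩ • ⁅y, m⁆ := hχ ⟨x, hx⟩ ⁅y, m⁆ (N.lie_mem hm)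
    rw [lie_lie, h1, h2, lie_smul, sub_self]
  -- hence it kills the supremum of the atoms, which is everything
  have htop : sSup {N : LieSubmodule k L M | IsAtom N} = ⊤ := sSup_atoms_eq_top
  have hker : (↑(sSup {N : LieSubmodule k L M | IsAtom N}) : Submodule k M) ≤
      LinearMap.ker ((toEnd k L M ⁅y, x⁆ : M →ₗ[k] M)) := by
    rw [LieSubmodule.sSup_toSubmodule_eq_iSup]
    refine iSup₂_le fun N hN => ?_
    intro m hm
    rw [LinearMap.mem_ker, toEnd_apply_apply]
    exact hatom N hN m hm
  have hm : m ∈ (↑(sSup {N : LieSubmodule k L M | IsAtom N}) : Submodule k M) := by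
    rw [htop]; exact Submodule.mem_top
  have := hker hm
  rwa [LinearMap.mem_ker, toEnd_apply_apply] at this

/-- **A finite-dimensional Lie algebra with a faithful, completely reducible, triangularizable finite-dimensional
representation is reductive: `rad L = Z(L)`** (`LieAlgebra.HasCentralRadical`). For `x ∈ rad L` and `y ∈ L`,
`⁅y, x⁆` acts by `0` (`lie_lie_radical_eq_zero`), hence vanishes (faithfulness), so `x` is central.
[cite: Humphreys1972, §19.1] -/
theorem hasCentralRadical_of_complementedLattice [ComplementedLattice (LieSubmodule k L M)] [IsFaithful k L M] :
    HasCentralRadical k L := by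
  refine hasCentralRadical_of_radical_le k L fun x hx => ?_
  rw [LieAlgebra.center, LieModule.mem_maxTrivSubmodule]
  intro y
  rw [← toEnd_eq_zero_iff (R := k) (L := L) (M := M)]
  ext m
  rw [toEnd_apply_apply, LinearMap.zero_apply]
  exact lie_lie_radical_eq_zero y hx m

/-- **… and semisimple if its centre is trivial: `rad L = 0`** (`LieAlgebra.HasTrivialRadical`; by Mathlib's Cartan
criterion `LieAlgebra.HasTrivialRadical.instIsKilling` the Killing form is then non-degenerate and `L` is
semisimple, `LieAlgebra.IsKilling.instSemisimple`). [cite: Humphreys1972, §19.1] -/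
theorem hasTrivialRadical_of_complementedLattice_of_center_eq_bot [ComplementedLattice (LieSubmodule k L M)]
    [IsFaithful k L M] (hZ : center k L = ⊥) : HasTrivialRadical k L := by
  haveI := hasCentralRadical_of_complementedLattice (k := k) (L := L) (M := M)
  exact ⟨by rw [radical_eq_center, hZ]⟩

/-- **Semisimplicity in Mathlib's strongest spelling**: under the same hypotheses `L` is a semisimple Lie algebra
(`LieAlgebra.IsSemisimple`: a direct sum of simple ideals), via Cartan's criterion. [cite: Humphreys1972, §19.1]
[cite: Humphreys1972, §5.1] -/
theorem isSemisimple_of_complementedLattice_of_center_eq_bot [ComplementedLattice (LieSubmodule k L M)]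
    [IsFaithful k L M] (hZ : center k L = ⊥) : IsSemisimple k L := by
  haveI := hasTrivialRadical_of_complementedLattice_of_center_eq_bot (k := k) (L := L) (M := M) hZ
  haveI : IsKilling k L := HasTrivialRadical.instIsKilling k L
  exact IsKilling.instSemisimple k L

end Literature.Algebra.Lie
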